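import Mathlib.Analysis.InnerProductSpace.Calculus
import Mathlib.Analysis.Calculus.Deriv.Inv
import Mathlib.Analysis.Calculus.Deriv.Mul
import Mathlib.Analysis.Calculus.FDeriv.Prod
import Mathlib.Analysis.Calculus.ContDiff.Basic
import Mathlib.LinearAlgebra.FiniteDimensional.Basic
import Mathlib.Topology.Algebra.Module.FiniteDimension
import HarnessLib

/-!
# Radial zones of the tube stage, I: cone-ification by source reparametrisation

Topic `Literature/Topology/FourManifolds`; Euclidean analysis in `E × F`, companion of
`TubeRadial.lean` (independent of it; codimension `≥ 2` steps of the smoothing of PD homeomorphisms: Munkres, Ann. of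
Math. 72 (1960), §§4–5; Campbell–D'Onofrio–Vítek, J. Geom. Anal. (2026), Lemma 3.2 Steps 2–3 /
Lemma 3.4 Step 2).  The device acts on the normal part `N : E × F → F` of a (flattened) stage
map, `t = ‖y‖`, `ŷ = y/t`:

* **Cone-ification** `coneifyMap N μ (x, y) = (t / μ t) • N (x, μ(t) ŷ)` along a radius pacing
  `μ` (`μ t = t` outside, `μ ≡ r₁` inside): outside it is `N`, inside it is the EXACT cone
  `t • V(x, ŷ)`, `V = r₁⁻¹ N(·, r₁ ·)`, over the link of `N` at radius `r₁`.  Its fibre derivative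
  is (`fderiv_coneifyMap_apply_inr`)
  `D_yφ w = D_yN(q) w − (⟪ŷ,w⟫(1−κ)/μ) • (D_yN(q)·q.2 − N q)`, `q = (x, μ ŷ)`, `κ = tμ'/μ`,
  so it is injective as soon as the **source-form Euler defect of `N` at `q` is smaller than the
  radius** (`D_yN(q) u = D_yN(q)·q.2 − N q ⟹ K₀‖u‖ < ‖q.2‖`) and `|1 − κ| ≤ K₀`
  (`injective_fderiv_coneifyStageMap`) — a POINTWISE first-order condition at the single point
  `q`, with no condition on the pacing beyond a bound on its exponent.  (CDV's "radial squeezing",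
  Lemma 3.2 Step 3, interpolates values instead and needs the derivative to be nearly constant
  along rays; the source reparametrisation avoids this.)
* The companion **rounding** zone (from the exact cone `t • V` to the round cone
  `t ρ • V/‖V‖`, CDV Lemma 3.4 Step 2) is treated in the sequel `TubeRound.lean`.

Everything is proved; the definitions are explicit functions; no named facts are introduced.

## References

* J. R. Munkres, *Obstructions to the smoothing of piecewise-differentiable homeomorphisms*, Ann.
  of Math. (2) 72 (1960), 521–554, §§4–5. [Munkres1960]
* D. Campbell, L. D'Onofrio, T. Vítek, *Diffeomorphic approximation of piecewise affine
  homeomorphisms*, J. Geom. Anal. 36 (2026), Lemma 3.2 (Steps 2–3), Lemma 3.4 (Step 2).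
  [CampbellDonofrioVitek2026]
-/

noncomputable section

open Set Function Metric Filter
open scoped Topology ContDiff RealInnerProductSpace

namespace Literature.Topology.FourManifolds

variable {E : Type*} [NormedAddCommGroup E] [NormedSpace ℝ E]
variable {F : Type*} [NormedAddCommGroup F] [InnerProductSpace ℝ F]

/-- `∞ ≠ 0` in the smoothness exponents (bookkeeping). [folklore] -/
private theorem zones_infty_ne_zero : (∞ : WithTop ℕ∞) ≠ 0 := by
  simp

/-! ### §1 One-variable calculus along a line in the fibre -/

section LineCalculus

variable {y w : F}

omit [NormedAddCommGroup E] [NormedSpace ℝ E] in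
/-- Derivative of the norm away from `0`: `D‖·‖(y) = ⟪y/‖y‖, ·⟫` (a private copy of the tree's
`Literature.Analysis.Potential.HyperbolicBall.hasFDerivAt_norm_of_ne_zero`). [folklore] -/
private theorem zones_hasFDerivAt_norm (hy : y ≠ 0) :
    HasFDerivAt (fun z : F => ‖z‖) (innerSL ℝ (‖y‖⁻¹ • y)) y := by
  have hy2 : ‖y‖ ^ 2 ≠ 0 := by positivity
  have h2 := (hasStrictFDerivAt_norm_sq y).hasFDerivAt.sqrt hy2
  have hfun : (fun z : F => ‖z‖) = fun z => Real.sqrt (‖z‖ ^ 2) := by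
    funext z
    rw [Real.sqrt_sq (norm_nonneg z)]
  rw [hfun]
  refine h2.congr_fderiv (ContinuousLinearMap.ext fun v => ?_)
  rw [Real.sqrt_sq (norm_nonneg y)]
  have hy0 : ‖y‖ ≠ 0 := norm_ne_zero_iff.2 hy
  simp only [innerSL_apply_apply, real_inner_smul_left]
  change (1 / (2 * ‖y‖)) • ((2 : ℕ) • innerSL ℝ y) v = ‖y‖⁻¹ * ⟪y, v⟫
  rw [two_nsmul]
  change (1 / (2 * ‖y‖)) * (⟪y, v⟫ + ⟪y, v⟫) = ‖y‖⁻¹ * ⟪y, v⟫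
  field_simp
  ring

omit [NormedAddCommGroup E] [NormedSpace ℝ E] in
/-- Derivative of `τ ↦ ‖y + τ • w‖` at `τ = 0`, `y ≠ 0`: it is `⟪ŷ, w⟫`. [folklore] -/
theorem hasDerivAt_norm_line (hy : y ≠ 0) :
    HasDerivAt (fun τ : ℝ => ‖y + τ • w‖) ⟪‖y‖⁻¹ • y, w⟫ 0 := by
  have hline : HasDerivAt (fun τ : ℝ => y + τ • w) w 0 := by
    have h := ((hasDerivAt_id (0 : ℝ)).smul_const w).const_add y
    rw [one_smul] at h
    exact h
  exact (zones_hasFDerivAt_norm hy).comp_hasDerivAt_of_eq (0 : ℝ) hline (by simp)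

omit [NormedAddCommGroup E] [NormedSpace ℝ E] in
/-- The line `τ ↦ y + τ • w` has derivative `w`. [folklore] -/
theorem hasDerivAt_line (y w : F) (τ₀ : ℝ) : HasDerivAt (fun τ : ℝ => y + τ • w) w τ₀ := by
  have h := ((hasDerivAt_id τ₀).smul_const w).const_add y
  rw [one_smul] at h
  exact h

end LineCalculus

/-! ### §2 Cone-ification -/

section Coneify

/-- **Cone-ification by source reparametrisation.** For `N : E × F → F` and a radius pacing
`μ : ℝ → ℝ`: `coneifyMap N μ (x, y) = (‖y‖ / μ ‖y‖) • N (x, (μ ‖y‖ / ‖y‖) • y)`, i.e. `N` read at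
radius `μ(‖y‖)` on the same ray and rescaled to be homogeneous of degree one wherever `μ` is
constant.  Munkres (1960), §4; Campbell–D'Onofrio–Vítek (2026), Lemma 3.2 Step 3 (there a value
interpolation). [cite: CampbellDonofrioVitek2026, Lemma 3.2 (Step 3)] -/
def coneifyMap (N : E × F → F) (μ : ℝ → ℝ) (p : E × F) : F :=
  (‖p.2‖ / μ ‖p.2‖) • N (p.1, (μ ‖p.2‖ / ‖p.2‖) • p.2)

/-- The cone-ified stage map `p ↦ (p.1, coneifyMap N μ p)`. [folklore] -/
def coneifyStageMap (N : E × F → F) (μ : ℝ → ℝ) (p : E × F) : E × F :=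
  (p.1, coneifyMap N μ p)

/-- The point at which `N` is read: `q = (x, (μ ‖y‖ / ‖y‖) • y)`. [folklore] -/
def coneifyPoint (μ : ℝ → ℝ) (p : E × F) : E × F :=
  (p.1, (μ ‖p.2‖ / ‖p.2‖) • p.2)

variable {N : E × F → F} {μ : ℝ → ℝ} {p : E × F}

omit [NormedAddCommGroup E] [NormedSpace ℝ E] in
/-- The stage map keeps the parameters. [folklore] -/
@[simp]
theorem coneifyStageMap_fst (p : E × F) : (coneifyStageMap N μ p).1 = p.1 := rfl

omit [NormedAddCommGroup E] [NormedSpace ℝ E] in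
/-- The fibre component of the stage map. [folklore] -/
@[simp]
theorem coneifyStageMap_snd (p : E × F) : (coneifyStageMap N μ p).2 = coneifyMap N μ p := rfl

omit [NormedAddCommGroup E] [NormedSpace ℝ E] in
/-- The reading point keeps the parameters. [folklore] -/
@[simp]
theorem coneifyPoint_fst (p : E × F) : (coneifyPoint μ p).1 = p.1 := rfl

omit [NormedAddCommGroup E] [NormedSpace ℝ E] in
/-- The norm of the reading point is `μ ‖y‖` (for `μ ‖y‖ ≥ 0`, `y ≠ 0`). [folklore] -/
theorem norm_coneifyPoint_snd (hp : p.2 ≠ 0) (hμ : 0 ≤ μ ‖p.2‖) : ‖(coneifyPoint μ p).2‖ = μ ‖p.2‖ := by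
  rw [coneifyPoint, norm_smul, Real.norm_of_nonneg (div_nonneg hμ (norm_nonneg _)),
    div_mul_cancel₀ _ (norm_ne_zero_iff.2 hp)]

omit [NormedAddCommGroup E] [NormedSpace ℝ E] in
/-- **Outside, cone-ification does nothing**: if `μ ‖y‖ = ‖y‖` then `coneifyMap N μ (x, y) = N (x, y)`.
[folklore] -/
theorem coneifyMap_of_eq_self (hp : p.2 ≠ 0) (hμ : μ ‖p.2‖ = ‖p.2‖) : coneifyMap N μ p = N p := by
  have ht : ‖p.2‖ ≠ 0 := norm_ne_zero_iff.2 hp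
  rw [coneifyMap, hμ, div_self ht, one_smul, one_smul]

omit [NormedAddCommGroup E] [NormedSpace ℝ E] in
/-- **Inside, cone-ification is the exact cone over the link at radius `r₁`**: if
`μ ‖y‖ = r₁` then `coneifyMap N μ (x, y) = ‖y‖ • (r₁⁻¹ • N (x, (r₁/‖y‖) • y))`. [folklore] -/
theorem coneifyMap_of_eq_const {r₁ : ℝ} (hμ : μ ‖p.2‖ = r₁) :
    coneifyMap N μ p = ‖p.2‖ • (r₁⁻¹ • N (p.1, (r₁ / ‖p.2‖) • p.2)) := by
  rw [coneifyMap, hμ, smul_smul, div_eq_mul_inv]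

omit [NormedAddCommGroup E] [NormedSpace ℝ E] in
/-- On the zero section the cone-ified map vanishes. [folklore] -/
theorem coneifyMap_zero (x : E) : coneifyMap N μ (x, 0) = 0 := by
  simp [coneifyMap]

/-- **Smoothness of cone-ification off the zero section**: `N` smooth at the reading point `q`,
`μ` smooth at `‖y‖` with `μ ‖y‖ ≠ 0`. [folklore] -/
theorem contDiffAt_coneifyMap (hp : p.2 ≠ 0) (hN : ContDiffAt ℝ ∞ N (coneifyPoint μ p))
    (hμ : ContDiffAt ℝ ∞ μ ‖p.2‖) (hμ0 : μ ‖p.2‖ ≠ 0) : ContDiffAt ℝ ∞ (coneifyMap N μ) p := by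
  have hn : ContDiffAt ℝ ∞ (fun q : E × F => ‖q.2‖) p := (contDiffAt_norm ℝ hp).comp p contDiffAt_snd
  have hμn : ContDiffAt ℝ ∞ (fun q : E × F => μ ‖q.2‖) p := hμ.comp p hn
  have hpt : ContDiffAt ℝ ∞ (fun q : E × F => ((q.1, (μ ‖q.2‖ / ‖q.2‖) • q.2) : E × F)) p :=
    contDiffAt_fst.prodMk ((hμn.div hn (norm_ne_zero_iff.2 hp)).smul contDiffAt_snd)
  have hNc : ContDiffAt ℝ ∞ (fun q : E × F => N (q.1, (μ ‖q.2‖ / ‖q.2‖) • q.2)) p :=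
    ContDiffAt.comp (g := N) (f := fun q : E × F => ((q.1, (μ ‖q.2‖ / ‖q.2‖) • q.2) : E × F)) p hN hpt
  exact (hn.div hμn hμ0).smul hNc

/-- Smoothness of the cone-ified stage map off the zero section. [folklore] -/
theorem contDiffAt_coneifyStageMap (hp : p.2 ≠ 0) (hN : ContDiffAt ℝ ∞ N (coneifyPoint μ p))
    (hμ : ContDiffAt ℝ ∞ μ ‖p.2‖) (hμ0 : μ ‖p.2‖ ≠ 0) : ContDiffAt ℝ ∞ (coneifyStageMap N μ) p :=
  contDiffAt_fst.prodMk (contDiffAt_coneifyMap hp hN hμ hμ0)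

/-- **The fibre derivative of cone-ification.** Let `y ≠ 0`, `t = ‖y‖`, `m = μ t ≠ 0`,
`m' = μ' t`, `q = (x, (m/t) • y)` the reading point, and let `N` be differentiable at `q`, `μ` at
`t`. Then for every `w`,
`D(coneifyMap)(x,y) (0, w) = DN(q)(0, w) − (⟪ŷ, w⟫ (1 − t m'/m) / m) • (DN(q)(0, q.2) − N q)`:
the fibre derivative of `N` at `q`, corrected by the Euler defect `DN(q)·q.2 − N q` of `N` at `q`
weighted by the radial component of `w`. [folklore] -/
theorem fderiv_coneifyMap_apply_inr (hp : p.2 ≠ 0) (hN : ContDiffAt ℝ ∞ N (coneifyPoint μ p))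
    (hμ : ContDiffAt ℝ ∞ μ ‖p.2‖) (hμ0 : μ ‖p.2‖ ≠ 0) (w : F) :
    fderiv ℝ (coneifyMap N μ) p (0, w) =
      fderiv ℝ N (coneifyPoint μ p) (0, w) -
        ((⟪‖p.2‖⁻¹ • p.2, w⟫ * (1 - ‖p.2‖ * deriv μ ‖p.2‖ / μ ‖p.2‖)) / μ ‖p.2‖) •
          (fderiv ℝ N (coneifyPoint μ p) (0, (coneifyPoint μ p).2) - N (coneifyPoint μ p)) := by
  -- notation
  obtain ⟨x, y⟩ := p
  simp only at hp hN hμ hμ0 ⊢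
  set t : ℝ := ‖y‖ with ht
  have ht0 : 0 < t := norm_pos_iff.2 hp
  have htne : t ≠ 0 := ht0.ne'
  set m : ℝ := μ t with hm
  set m' : ℝ := deriv μ t with hm'
  set a : ℝ := ⟪‖y‖⁻¹ • y, w⟫ with ha
  set q : E × F := coneifyPoint μ (x, y) with hq
  have hq2 : q.2 = (m / t) • y := rfl
  set L := fderiv ℝ N q with hL
  -- (1) the derivative along the line `τ ↦ (x, y + τ w)` equals `Dφ (0, w)`
  have hd : DifferentiableAt ℝ (coneifyMap N μ) (x, y) :=
    (contDiffAt_coneifyMap (p := (x, y)) hp hN hμ hμ0).differentiableAt zones_infty_ne_zero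
  have hl : HasDerivAt (fun τ : ℝ => y + τ • w) w 0 := hasDerivAt_line y w 0
  have hline : HasDerivAt (fun τ : ℝ => (((x, y + τ • w)) : E × F)) (((0 : E), w) : E × F) 0 :=
    (hasDerivAt_const (0 : ℝ) x).prodMk hl
  have h1 : HasDerivAt (fun τ : ℝ => coneifyMap N μ (x, y + τ • w))
      (fderiv ℝ (coneifyMap N μ) (x, y) (0, w)) 0 :=
    hd.hasFDerivAt.comp_hasDerivAt_of_eq (0 : ℝ) hline (by simp)
  -- (2) the same derivative by the product/chain rules
  have hnorm : HasDerivAt (fun τ : ℝ => ‖y + τ • w‖) a 0 := hasDerivAt_norm_line hp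
  have hμd : HasDerivAt μ m' t := (hμ.differentiableAt zones_infty_ne_zero).hasDerivAt
  have hμτ : HasDerivAt (fun τ : ℝ => μ ‖y + τ • w‖) (m' * a) 0 :=
    hμd.comp_of_eq 0 hnorm (by rw [zero_smul, add_zero])
  -- values at `τ = 0`
  have hv0 : ‖y + (0 : ℝ) • w‖ = t := by rw [zero_smul, add_zero]
  have hμv0 : μ ‖y + (0 : ℝ) • w‖ = m := by rw [zero_smul, add_zero]
  -- `c₁ = t/μ`, `c₂ = μ/t`
  have hc₁ : HasDerivAt (fun τ : ℝ => ‖y + τ • w‖ / μ ‖y + τ • w‖)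
      ((a * m - t * (m' * a)) / m ^ 2) 0 := by
    have := hnorm.fun_div hμτ (by rw [hμv0]; exact hμ0)
    rw [hv0] at this
    exact this
  have hc₂ : HasDerivAt (fun τ : ℝ => μ ‖y + τ • w‖ / ‖y + τ • w‖)
      ((m' * a * t - m * a) / t ^ 2) 0 := by
    have := hμτ.fun_div hnorm (by rw [hv0]; exact htne)
    rw [hv0] at this
    exact this
  -- the reading point along the line and `N` there
  have hζ2 : HasDerivAt (fun τ : ℝ => (μ ‖y + τ • w‖ / ‖y + τ • w‖) • (y + τ • w))
      (((m' * a * t - m * a) / t ^ 2) • y + (m / t) • w) 0 := by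
    have := hc₂.fun_smul hl
    rw [zero_smul, add_zero, add_comm] at this
    exact this
  have hζ : HasDerivAt (fun τ : ℝ => (((x, (μ ‖y + τ • w‖ / ‖y + τ • w‖) • (y + τ • w))) : E × F))
      (((0 : E), ((m' * a * t - m * a) / t ^ 2) • y + (m / t) • w) : E × F) 0 :=
    (hasDerivAt_const (0 : ℝ) x).prodMk hζ2
  have hNd : HasFDerivAt N L q := (hN.differentiableAt zones_infty_ne_zero).hasFDerivAt
  have hNζ : HasDerivAt (fun τ : ℝ => N (x, (μ ‖y + τ • w‖ / ‖y + τ • w‖) • (y + τ • w)))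
      (L (0, ((m' * a * t - m * a) / t ^ 2) • y + (m / t) • w)) 0 :=
    hNd.comp_hasDerivAt_of_eq (0 : ℝ) hζ (by rw [zero_smul, add_zero]; rfl)
  have h2 : HasDerivAt (fun τ : ℝ => coneifyMap N μ (x, y + τ • w))
      (((a * m - t * (m' * a)) / m ^ 2) • N q +
        (t / m) • L (0, ((m' * a * t - m * a) / t ^ 2) • y + (m / t) • w)) 0 := by
    have := hc₁.fun_smul hNζ
    rw [zero_smul, add_zero, add_comm] at this
    exact this
  -- (3) compare and simplify
  rw [h1.unique h2]
  -- linearity of `L` in the fibre slot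
  have hlin : L (0, ((m' * a * t - m * a) / t ^ 2) • y + (m / t) • w) =
      ((m' * a * t - m * a) / t ^ 2) • L (0, y) + (m / t) • L (0, w) := by
    have : (((0 : E), ((m' * a * t - m * a) / t ^ 2) • y + (m / t) • w) : E × F) =
        ((m' * a * t - m * a) / t ^ 2) • ((0 : E), y) + (m / t) • ((0 : E), w) := by
      ext <;> simp
    rw [this, map_add, map_smul, map_smul]
  have hy : L (0, y) = (t / m) • L (0, q.2) := by
    rw [hq2, ← map_smul]
    congr 1
    ext
    · simp
    · simp only [Prod.smul_snd, smul_smul, div_mul_div_comm, mul_comm t m,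
        div_self (mul_ne_zero hμ0 htne), one_smul]
  rw [hlin, hy, smul_add, smul_smul, smul_smul, smul_smul]
  -- scalar bookkeeping
  have hm0 : m ≠ 0 := hμ0
  have e1 : t / m * (m / t) = 1 := by field_simp
  have e2 : t / m * ((m' * a * t - m * a) / t ^ 2) * (t / m) = -(a * (1 - t * m' / m) / m) := by
    field_simp
    ring
  have e3 : (a * m - t * (m' * a)) / m ^ 2 = a * (1 - t * m' / m) / m := by
    field_simp
  rw [e1, one_smul, e2, e3, smul_sub, neg_smul]
  abel

/-- **Nondegeneracy of cone-ification** (pointwise first-order criterion). With the notation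
of `fderiv_coneifyMap_apply_inr`, assume that the fibre derivative `u ↦ DN(q)(0, u)` of `N` at
the reading point `q` is injective, that the **source-form Euler defect of `N` at `q` is smaller
than the radius by the factor `K₀`** — `DN(q)(0,u) = DN(q)(0, q.2) − N q ⟹ K₀‖u‖ < ‖q.2‖` — and
that the pacing exponent `κ = t μ'(t)/μ(t)` satisfies `|1 − κ| ≤ K₀` (so any pacing with bounded
exponent is admissible once the defect is small enough; `K₀ = 1` for `κ ∈ [0, 2]`), `μ t > 0`.  Then the derivative of the cone-ified stage map at `p = (x, y)` is injective:
if `Dφ (0, w) = 0` then `DN(q)(0, w) = (⟪ŷ,w⟫(1−κ)/m) • defect`, so either `⟪ŷ,w⟫(1−κ) = 0` and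
`w = 0` by injectivity, or `u = (m/(⟪ŷ,w⟫(1−κ))) • w` is a preimage of the defect, whence
`K₀‖u‖ < m`, i.e. `K₀‖w‖ < |⟪ŷ,w⟫| |1−κ| ≤ K₀‖w‖`, absurd. [folklore] -/
theorem injective_fderiv_coneifyStageMap (hp : p.2 ≠ 0)
    (hN : ContDiffAt ℝ ∞ N (coneifyPoint μ p)) (hμ : ContDiffAt ℝ ∞ μ ‖p.2‖) (hμ0 : 0 < μ ‖p.2‖)
    (hinj : ∀ u : F, fderiv ℝ N (coneifyPoint μ p) (0, u) = 0 → u = 0)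
    {K₀ : ℝ} (hK₀ : 0 < K₀)
    (hdef : ∀ u : F, fderiv ℝ N (coneifyPoint μ p) (0, u) =
      fderiv ℝ N (coneifyPoint μ p) (0, (coneifyPoint μ p).2) - N (coneifyPoint μ p) →
        K₀ * ‖u‖ < ‖(coneifyPoint μ p).2‖)
    (hκ : |1 - ‖p.2‖ * deriv μ ‖p.2‖ / μ ‖p.2‖| ≤ K₀) :
    Injective (fderiv ℝ (coneifyStageMap N μ) p) := by
  have hd : DifferentiableAt ℝ (coneifyMap N μ) p :=
    (contDiffAt_coneifyMap hp hN hμ hμ0.ne').differentiableAt zones_infty_ne_zero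
  have hΦ : HasFDerivAt (coneifyStageMap N μ)
      ((ContinuousLinearMap.fst ℝ E F).prod (fderiv ℝ (coneifyMap N μ) p)) p :=
    hasFDerivAt_fst.prodMk hd.hasFDerivAt
  rw [hΦ.fderiv]
  refine (injective_iff_map_eq_zero _).2 fun vw h => ?_
  obtain ⟨v, w⟩ := vw
  have h1 := congrArg Prod.fst h
  have h2 := congrArg Prod.snd h
  simp only [ContinuousLinearMap.prod_apply, ContinuousLinearMap.coe_fst', Prod.fst_zero] at h1
  subst h1
  simp only [ContinuousLinearMap.prod_apply, Prod.snd_zero] at h2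
  -- `h2 : Dφ (0, w) = 0`
  rw [fderiv_coneifyMap_apply_inr hp hN hμ hμ0.ne' w, sub_eq_zero] at h2
  set q := coneifyPoint μ p with hq
  set m : ℝ := μ ‖p.2‖ with hm
  set a : ℝ := ⟪‖p.2‖⁻¹ • p.2, w⟫ with ha
  set k : ℝ := 1 - ‖p.2‖ * deriv μ ‖p.2‖ / μ ‖p.2‖ with hk
  set d : F := fderiv ℝ N q (0, q.2) - N q with hd'
  have hqn : ‖q.2‖ = m := norm_coneifyPoint_snd hp hμ0.le
  -- `|a| ≤ ‖w‖`
  have ha_le : |a| ≤ ‖w‖ := by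
    have h := abs_real_inner_le_norm (‖p.2‖⁻¹ • p.2) w
    rwa [norm_smul, norm_inv, norm_norm, inv_mul_cancel₀ (norm_ne_zero_iff.2 hp), one_mul] at h
  by_cases hc : a * k = 0
  · rw [hc, zero_div, zero_smul] at h2
    have hw : w = 0 := hinj w h2
    rw [hw]
    rfl
  · -- a preimage of the defect
    have hu : fderiv ℝ N q (0, (m / (a * k)) • w) = d := by
      have : (((0 : E), (m / (a * k)) • w) : E × F) = (m / (a * k)) • ((0 : E), w) := by
        ext <;> simp
      rw [this, map_smul, h2, smul_smul, div_mul_div_cancel₀ hc, div_self hμ0.ne', one_smul]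
    have hlt := hdef _ hu
    rw [hqn, norm_smul, norm_div, Real.norm_of_nonneg hμ0.le, norm_mul] at hlt
    -- `K₀ m/(|a||k|) ‖w‖ < m` gives `K₀ ‖w‖ < |a| |k| ≤ |a| K₀ ≤ ‖w‖ K₀`
    have hak : 0 < ‖a‖ * ‖k‖ := by
      rw [← norm_mul]; exact norm_pos_iff.2 hc
    have h3 : K₀ * ‖w‖ < ‖a‖ * ‖k‖ := by
      rw [div_mul_eq_mul_div, mul_div_assoc'] at hlt
      by_contra hge
      have hge' : ‖a‖ * ‖k‖ ≤ K₀ * ‖w‖ := le_of_not_gt hge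
      have : m ≤ K₀ * (m * ‖w‖) / (‖a‖ * ‖k‖) := by
        rw [le_div_iff₀ hak]
        nlinarith [norm_nonneg w, hμ0.le]
      exact absurd hlt (not_lt.2 this)
    have h4 : ‖a‖ * ‖k‖ ≤ ‖a‖ * K₀ := mul_le_mul_of_nonneg_left hκ (norm_nonneg a)
    rw [Real.norm_eq_abs] at h4
    have h5 : |a| * K₀ ≤ ‖w‖ * K₀ := mul_le_mul_of_nonneg_right ha_le hK₀.le
    have : K₀ * ‖w‖ < K₀ * ‖w‖ := by
      calc K₀ * ‖w‖ < ‖a‖ * ‖k‖ := h3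
        _ ≤ |a| * K₀ := by rw [← Real.norm_eq_abs]; exact h4
        _ ≤ ‖w‖ * K₀ := h5
        _ = K₀ * ‖w‖ := mul_comm _ _
    exact absurd this (lt_irrefl _)

/-- Packaged form for the inverse function theorem: under the hypotheses of
`injective_fderiv_coneifyStageMap` (finite-dimensional `E`, `F`) the derivative of the
cone-ified stage map is a linear isomorphism. [folklore] -/
theorem exists_hasFDerivAt_equiv_coneifyStageMap [FiniteDimensional ℝ E] [FiniteDimensional ℝ F]
    (hp : p.2 ≠ 0) (hN : ContDiffAt ℝ ∞ N (coneifyPoint μ p)) (hμ : ContDiffAt ℝ ∞ μ ‖p.2‖)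
    (hμ0 : 0 < μ ‖p.2‖) (hinj : ∀ u : F, fderiv ℝ N (coneifyPoint μ p) (0, u) = 0 → u = 0)
    {K₀ : ℝ} (hK₀ : 0 < K₀)
    (hdef : ∀ u : F, fderiv ℝ N (coneifyPoint μ p) (0, u) =
      fderiv ℝ N (coneifyPoint μ p) (0, (coneifyPoint μ p).2) - N (coneifyPoint μ p) →
        K₀ * ‖u‖ < ‖(coneifyPoint μ p).2‖)
    (hκ : |1 - ‖p.2‖ * deriv μ ‖p.2‖ / μ ‖p.2‖| ≤ K₀) :
    ∃ L : (E × F) ≃L[ℝ] E × F,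
      HasFDerivAt (coneifyStageMap N μ) (L : E × F →L[ℝ] E × F) p := by
  have hd : DifferentiableAt ℝ (coneifyStageMap N μ) p :=
    (contDiffAt_coneifyStageMap hp hN hμ hμ0.ne').differentiableAt zones_infty_ne_zero
  have hinj' := injective_fderiv_coneifyStageMap hp hN hμ hμ0 hinj hK₀ hdef hκ
  let L : (E × F) ≃L[ℝ] E × F :=
    LinearEquiv.toContinuousLinearEquiv
      (LinearEquiv.ofInjectiveEndo (fderiv ℝ (coneifyStageMap N μ) p).toLinearMap hinj')
  refine ⟨L, ?_⟩
  have hcoe : (L : E × F →L[ℝ] E × F) = fderiv ℝ (coneifyStageMap N μ) p :=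
    ContinuousLinearMap.ext fun v => rfl
  rw [hcoe]
  exact hd.hasFDerivAt

end Coneify

end Literature.Topology.FourManifolds
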